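import Summits.ResolutionOfSingularities.ResolutionOfSingularities.Theorems.FrobeniusLadderFRationalResolutionMonoidAlgebraChartCertificate
import Summits.ResolutionOfSingularities.ResolutionOfSingularities.Theorems.FrobeniusLadderFRationalResolutionMonoidAlgebraReduction
import HarnessLib

/-!
# Crux `FrobeniusLadder.FRationalResolution` (stmt-ResolutionOfSingularities-15317), line `redirect`,
# stub `stub_diagonalizableQuotientResolution` — THE MODEL-SIDE CERTIFICATE OF THE NAIVE TWO-STEP RECIPE FROM CONE DATA (pure algebra,
# any field): generators, reduction and per-chart certificates of `κ[P]` packaged in the shape consumed by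
# `…MonoidAlgebraModel.hasResolution_of_isolated_fixedPoints_of_monoidAlgebra_certificate`

Chains `…MonoidAlgebraVertexGenerators` (p843511), `…MonoidAlgebraReduction` (p843517) and `…MonoidAlgebraChartCertificate.chartCertificate_of_cone`
(p843560) for the point blow-up (`b = 0`) of the monoid algebra `κ[P]` of a weight kernel `P = ⟨G⟩`: from an enumeration `gen` of `G`,
non-zero vertices `v`, exponent identities `(jᵢ+1) • genᵢ = v_{c i} + Σ qᵢ` (`jᵢ + 1 ≤ k`) and, per vertex, the cone data `(Q, ι, G_Q)`
with regular faces and a vertex certificate over every field, it PRODUCES the model-side slots `(b, xv, hxv, y, hyJ, N, hred, hcert)` of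
the consumer, for an ARBITRARY field `κ` (so a class certificate is proved once, uniformly in the field, and instantiated at `κ(𝔮)`).

* ★★★ `modelCertificate_of_cone` — the packaged model-side certificate.

Honest label: assembly toward ONE leaf stub (no stub, crux or summit closed). No definitions, no named facts, no sorry.
[folklore; cite: CoxLittleSchenck2011, §1.1, §3.3] [cite: Kato1994, Thm. (3.2)]
-/

noncomputable section

-- single-problem summit: the doubled namespace component is forced
set_option linter.dupNamespace false

open AlgebraicGeometry IsLocalRing
open Literature.AlgebraicGeometry.Resolution

namespace Summit.ResolutionOfSingularities.ResolutionOfSingularities.Theorems.FRationalResolution.MonoidAlgebraLaurent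

variable (κ : Type) [Field κ] {n : ℕ} (P : AddSubmonoid (Fin n →₀ ℕ))

/-- The exponent of `p ∈ ℕⁿ` in `ℤⁿ`. -/
local notation3 (prettyPrint := false) "toZ" =>
  (Finsupp.mapRange.addMonoidHom (Nat.castAddMonoidHom ℤ) : (Fin n →₀ ℕ) →+ (Fin n →₀ ℤ))

/-- The vertex ideal of the monoid algebra `κ[P]`. -/
local notation3 (prettyPrint := false) "𝕍[" κ ", " P "]" =>
  Ideal.span ((fun p : ↥P => AddMonoidAlgebra.single p (1 : κ)) '' {p : ↥P | p ≠ 0})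

/-- ★★★ **THE MODEL-SIDE CERTIFICATE FROM CONE DATA.** See the module docstring. The conclusion is, verbatim, the model-side part
(`b, nx, xv, hxv, m, y, hyJ, N, hred` and the per-chart certificates) of the data of
`…MonoidAlgebraModel.hasResolution_of_isolated_fixedPoints_of_monoidAlgebra_certificate`, with `b = 0`.
[folklore; cite: CoxLittleSchenck2011, §1.1, §3.3] -/
theorem modelCertificate_of_cone
    (G : Set (Fin n →₀ ℕ)) (hG0 : (0 : Fin n →₀ ℕ) ∉ G) (hGP : AddSubmonoid.closure G = P)
    {N : ℕ} (gen : Fin N → ↥P) (hgenG : ∀ i, ((gen i : ↥P) : Fin n →₀ ℕ) ∈ G) (hGgen : ∀ g ∈ G, ∃ i, ((gen i : ↥P) : Fin n →₀ ℕ) = g)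
    {m : ℕ} (v : Fin m → ↥P) (hv0 : ∀ j, v j ≠ 0)
    (kk : ℕ) (hkk : 1 ≤ kk) (c : Fin N → Fin m) (jj : Fin N → ℕ) (hjj : ∀ i, jj i + 1 ≤ kk)
    (q : ∀ i, Fin (jj i) → ↥P) (hq0 : ∀ i l, q i l ≠ 0) (hid : ∀ i, (jj i + 1) • gen i = v (c i) + ∑ l, q i l)
    (hcone : ∀ j : Fin m, ∃ (n' : ℕ) (Q : AddSubmonoid (Fin n' →₀ ℕ)) (ι : ↥Q →+ (Fin n →₀ ℤ)) (_ : Function.Injective ι)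
      (_ : ∀ e : ↥P, e ≠ 0 → ∃ u : ↥Q, ι u = toZ (e : Fin n →₀ ℕ) - toZ ((v j : ↥P) : Fin n →₀ ℕ))
      (_ : ∀ p : ↥P, ∃ u : ↥Q, ι u = toZ (p : Fin n →₀ ℕ))
      (_ : ∀ u : ↥Q, ∃ (p : ↥P) (r : ℕ) (e : Fin r → ↥P), (∀ i, e i ≠ 0) ∧
        ι u = toZ (p : Fin n →₀ ℕ) + ∑ i, (toZ ((e i : ↥P) : Fin n →₀ ℕ) - toZ ((v j : ↥P) : Fin n →₀ ℕ)))
      (GQ : Set (Fin n' →₀ ℕ)) (_ : GQ.Finite) (_ : (0 : Fin n' →₀ ℕ) ∉ GQ) (_ : AddSubmonoid.closure GQ = Q),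
      (∀ u : ↥Q, (u : Fin n' →₀ ℕ) ∈ GQ → IsRegularRing (Localization.Away (AddMonoidAlgebra.single u (1 : κ)))) ∧
      (∀ (K : Type) [Field K], Scheme.IsRegular (affineBlowup (Ideal.span {w : ↥(Algebra.adjoin K
        ((fun d : Fin n' →₀ ℕ => MvPolynomial.monomial d (1 : K)) '' GQ)) |
        ∃ d ∈ GQ, (w : MvPolynomial (Fin n') K) = MvPolynomial.monomial d 1})))) :
    ∃ (b nx : ℕ) (xv : Fin nx → AddMonoidAlgebra κ ↥P) (_ : 𝕍[κ, P] ^ (b + 1) = Ideal.span (Set.range xv))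
      (m' : ℕ) (y : Fin m' → AddMonoidAlgebra κ ↥P) (_ : ∀ j, y j ∈ 𝕍[κ, P] ^ (b + 1)) (N' : ℕ)
      (_ : (𝕍[κ, P] ^ (b + 1)) ^ (N' + 1) ≤ Ideal.span (Set.range y) * (𝕍[κ, P] ^ (b + 1)) ^ N'),
      ∀ j : Fin m', ∃ (G' : Set (blowupAlgebra (𝕍[κ, P] ^ (b + 1)) (y j))) (𝔪 : Ideal (blowupAlgebra (𝕍[κ, P] ^ (b + 1)) (y j)))
        (_ : 𝔪.IsMaximal) (M : ℕ),
        (∀ g ∈ G', IsRegularRing (Localization.Away g)) ∧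
        𝔪 ^ M ≤ (𝕍[κ, P]).map (algebraMap _ (blowupAlgebra (𝕍[κ, P] ^ (b + 1)) (y j))) ⊔ Ideal.span G' ∧
        (¬ IsRegularLocalRing (Localization.AtPrime 𝔪) →
          Scheme.IsRegular (affineBlowup (R := Localization.AtPrime 𝔪) (maximalIdeal (Localization.AtPrime 𝔪)))) := by
  have hgen0 : ∀ i, gen i ≠ 0 := fun i h => hG0 (by simpa [h] using hgenG i)
  have hV1 : 𝕍[κ, P] ^ (0 + 1) = 𝕍[κ, P] := by rw [zero_add, pow_one]
  have hxv : 𝕍[κ, P] ^ (0 + 1) = Ideal.span (Set.range fun i => AddMonoidAlgebra.single (gen i) (1 : κ)) := by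
    rw [hV1, MonoidAlgebraModel.vertexIdeal_eq_span_image κ P G hG0 hGP]
    congr 1
    ext z
    constructor
    · rintro ⟨p, hp, rfl⟩
      obtain ⟨i, hi⟩ := hGgen _ hp
      exact ⟨i, by change AddMonoidAlgebra.single (gen i) (1 : κ) = AddMonoidAlgebra.single p 1; rw [Subtype.ext hi]⟩
    · rintro ⟨i, rfl⟩
      exact ⟨gen i, hgenG i, rfl⟩
  have hyJ : ∀ j, AddMonoidAlgebra.single (v j) (1 : κ) ∈ 𝕍[κ, P] ^ (0 + 1) := fun j => by
    rw [hV1]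
    exact MonoidAlgebraModel.single_mem_vertexIdeal κ P (v j) (hv0 j)
  have hred : (𝕍[κ, P] ^ (0 + 1)) ^ (N * (kk - 1) + 1) ≤
      Ideal.span (Set.range fun j => AddMonoidAlgebra.single (v j) (1 : κ)) * (𝕍[κ, P] ^ (0 + 1)) ^ (N * (kk - 1)) := by
    rw [hV1]
    exact MonoidAlgebraModel.vertexIdeal_pow_le_of_nsmul_eq κ P (fun i => AddMonoidAlgebra.single (gen i) 1) gen hgen0
      (fun _ => rfl) (by rw [← hxv, hV1]) (Ideal.span (Set.range fun j => AddMonoidAlgebra.single (v j) (1 : κ)))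
      (fun i => v (c i)) (fun i => Ideal.subset_span ⟨c i, rfl⟩) kk hkk jj hjj q hq0 hid
  refine ⟨0, N, fun i => AddMonoidAlgebra.single (gen i) 1, hxv, m, fun j => AddMonoidAlgebra.single (v j) 1, hyJ, N * (kk - 1),
    hred, fun j => ?_⟩
  obtain ⟨n', Q, ι, hι, hE, hPQ, hQ, GQ, hGQfin, hGQ0, hGQ, hface, hvert⟩ := hcone j
  -- the certificate for the chart at `vⱼ`, transported along `𝔳^(0+1) = 𝔳`
  have key : ∀ I : Ideal (AddMonoidAlgebra κ ↥P), I = 𝕍[κ, P] →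
      ∃ (G' : Set (blowupAlgebra I (AddMonoidAlgebra.single (v j) (1 : κ))))
        (𝔪 : Ideal (blowupAlgebra I (AddMonoidAlgebra.single (v j) (1 : κ)))) (_ : 𝔪.IsMaximal) (M : ℕ),
        (∀ g ∈ G', IsRegularRing (Localization.Away g)) ∧
        𝔪 ^ M ≤ (𝕍[κ, P]).map (algebraMap _ (blowupAlgebra I (AddMonoidAlgebra.single (v j) (1 : κ)))) ⊔ Ideal.span G' ∧
        (¬ IsRegularLocalRing (Localization.AtPrime 𝔪) →
          Scheme.IsRegular (affineBlowup (R := Localization.AtPrime 𝔪) (maximalIdeal (Localization.AtPrime 𝔪)))) := by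
    intro I hI
    subst hI
    exact chartCertificate_of_cone κ P (v j) {p : ↥P | p ≠ 0} Q ι hι (fun e he => hE e he) hPQ
      (fun u => by obtain ⟨p, r, e, he, hu⟩ := hQ u; exact ⟨p, r, e, he, hu⟩) GQ hGQfin hGQ0 hGQ hface hvert _
  exact key _ hV1

end Summit.ResolutionOfSingularities.ResolutionOfSingularities.Theorems.FRationalResolution.MonoidAlgebraLaurent

end
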